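import Summits.CriticalPhenomena.PercolationContinuityZ3.Theses.PercNearOneGluing
import Summits.CriticalPhenomena.PercolationContinuityZ3.Theorems.PercNearOneGluingAdditiveGluingGoodStepOneBond
import Summits.CriticalPhenomena.PercolationContinuityZ3.Theorems.PercNearOneGluingAdditiveGluingGlueReach
import Literature.Probability.Percolation.KozmaNitzanPreFKG
import HarnessLib

/-! # Crux `PercNearOneGluing.AdditiveGluing` (stmt-CriticalPhenomena-4576), line `starglue` — stub `stub_starGlueRelay_sg`

Support file (`--supports stmt-CriticalPhenomena-4576`); no definitions, no named facts.  Proves exactly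
the registered stub `stub_starGlueRelay_sg` of the skeleton `Cruxes/AdditiveGluing/Lines/starglue.lean`:
the STAR step (glued star pair `e = s(o, y)`, `w e = 0`, `w₁ = w[e ↦ 1]`, `a₀` a minimiser of
`P_w(· ↔ b)` on `A`) in the RELAY case `y ∈ A` (with `b ∈ A`):

  `P_{w₁}(o ↔ A) − (1 − P_{w₁}(a₀ ↔ b)) ≤ P_{w₁}(o ↔ b)`.

## Proof

Since `P_{w₁}(o ↔ A) ≤ 1`, it suffices to show `P_{w₁}(a₀ ↔ b) ≤ P_{w₁}(o ↔ b)`.  Opening the pair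
`e` is the glue pushforward (`goodStep_real_update_one`): `P_{w₁}(S) = P_w {ω | ω ∪ {e} ∈ S}`, and by
`stub_glueReach` for the block `B = {o, y}` (whose non-loop pairs are exactly `{e}`,
`goodStep_pair_iff`), `ω ∪ {e} ∈ {x ↔ z}` iff `x ↔ z` or (`x ↔ B` and `B ↔ z`) in `ω`.  Hence
`P_{w₁}(a₀ ↔ b) = P_w({a₀ ↔ b} ∪ ({a₀ ↔ B} ∩ {B ↔ b}))` and `P_w(B ↔ b) ≤ P_{w₁}(o ↔ b)`, and the
Kozma–Nitzan gluing step `KNPreFKG.real_union_le_of_le` (one Lemma 3(ii) exchange with the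
decreasing event `{a₀ ↮ B}`, using the minimiser hypothesis `P_w(a₀ ↔ b) ≤ P_w(y ↔ b)` at the relay
`y ∈ A ∩ B`) gives `P_w({a₀ ↔ b} ∪ ({a₀ ↔ B} ∩ {B ↔ b})) ≤ P_w(B ↔ b)`.
[cite: KozmaNitzan2024, Lemma 3(ii) (pp. 6–7), Lemma 5 (p. 13)]
-/

namespace Summit.CriticalPhenomena.PercolationContinuityZ3.Theorems

open MeasureTheory Set Literature.Probability.LatticeModels Literature.Probability.Percolation
open scoped Classical BigOperators

noncomputable section

/-- **Reachability after opening one pair** `e = s(o, y)`, `o ≠ y`: `x ↔ z` in `ω ∪ {e}` iff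
`x ↔ z` in `ω`, or `x` reaches `{o, y}` and `{o, y}` reaches `z` in `ω` (`stub_glueReach` for the
two-point block). [folklore] -/
theorem starGlueRelay_union_pair_mem_openConn_iff {n : ℕ} {o y : Fin n} (hoy : o ≠ y)
    (ω : BondConfig (Fin n)) (x z : Fin n) :
    ω ∪ {s(o, y)} ∈ openConn x z ↔
      (ω ∈ openConn x z ∨
        ((∃ s ∈ ({o, y} : Finset (Fin n)), ω ∈ openConn x s) ∧
          (∃ s ∈ ({o, y} : Finset (Fin n)), ω ∈ openConn s z))) := by
  have hset : ({s(o, y)} : Set (Sym2 (Fin n))) =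
      {e : Sym2 (Fin n) | (∀ v ∈ e, v ∈ ({o, y} : Finset (Fin n))) ∧ ¬ e.IsDiag} := by
    ext e
    rw [Set.mem_setOf_eq, Set.mem_singleton_iff]
    exact (goodStep_pair_iff hoy e).symm
  rw [hset]
  exact stub_glueReach n {o, y} ω x z

/-- **Registered stub `stub_starGlueRelay_sg`** (line `starglue`, STAR step in the relay case
`y ∈ A`, `b ∈ A`): for the glued weight function `w₁ = w[s(o, y) ↦ 1]` and a minimiser `a₀` of
`P_w(· ↔ b)` on `A`, `P_{w₁}(o ↔ A) − (1 − P_{w₁}(a₀ ↔ b)) ≤ P_{w₁}(o ↔ b)`.  One Kozma–Nitzan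
Lemma 3(ii) exchange (`KNPreFKG.real_union_le_of_le` with the block `{o, y}` and the relay `y`).
[cite: KozmaNitzan2024, Lemma 3(ii) (pp. 6–7), Lemma 5 (p. 13)] -/
theorem stub_starGlueRelay_sg : ∀ (n : ℕ) (w : Sym2 (Fin n) → unitInterval) (A : Finset (Fin n)) (o y b a₀ : Fin n),
    b ∈ A → o ∉ A → y ≠ o → w s(o, y) = 0 → a₀ ∈ A →
    (∀ a ∈ A, (prodBernoulli w).real (openConn a₀ b) ≤ (prodBernoulli w).real (openConn a b)) →
    y ∈ A →
    (prodBernoulli (Function.update w s(o, y) 1)).real (⋃ a ∈ A, openConn o a)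
        - (1 - (prodBernoulli (Function.update w s(o, y) 1)).real (openConn a₀ b))
      ≤ (prodBernoulli (Function.update w s(o, y) 1)).real (openConn o b) := by
  intro n w A o y b a₀ _hb _ho hyo _hw ha₀ hmin hy
  have hoy : o ≠ y := fun h => hyo h.symm
  -- `P_{w₁}(o ↔ A) ≤ 1`, so it suffices to compare `P_{w₁}(a₀ ↔ b)` with `P_{w₁}(o ↔ b)`.
  have h1 : (prodBernoulli (Function.update w s(o, y) 1)).real (⋃ a ∈ A, openConn o a) ≤ 1 :=
    measureReal_le_one
  suffices h2 : (prodBernoulli (Function.update w s(o, y) 1)).real (openConn a₀ b) ≤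
      (prodBernoulli (Function.update w s(o, y) 1)).real (openConn o b) by
    linarith
  -- glue pushforward: `P_{w₁}(S) = P_w {ω | ω ∪ {e} ∈ S}`
  rw [goodStep_real_update_one w hoy, goodStep_real_update_one w hoy]
  -- the block `B = {o, y}` as a set of vertices, with `y ∈ B`
  have hyB : y ∈ (↑({o, y} : Finset (Fin n)) : Set (Fin n)) := by simp
  have hoB : o ∈ ({o, y} : Finset (Fin n)) := by simp
  -- Kozma–Nitzan gluing step: `P_w({a₀ ↔ b} ∪ ({a₀ ↔ B} ∩ {B ↔ b})) ≤ P_w(B ↔ b)`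
  have key := KNPreFKG.real_union_le_of_le w a₀ y b (↑({o, y} : Finset (Fin n)) : Set (Fin n))
    hyB (hmin y hy)
  calc (prodBernoulli w).real {ω : BondConfig (Fin n) | ω ∪ {s(o, y)} ∈ openConn a₀ b}
      = (prodBernoulli w).real ((openConn a₀ b : Set (BondConfig (Fin n))) ∪
          ({ω | ∃ u ∈ (↑({o, y} : Finset (Fin n)) : Set (Fin n)), (openGraph ω).Reachable a₀ u} ∩
            {ω | ∃ u ∈ (↑({o, y} : Finset (Fin n)) : Set (Fin n)), (openGraph ω).Reachable u b})) := by
        congr 1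
        ext ω
        rw [Set.mem_setOf_eq, starGlueRelay_union_pair_mem_openConn_iff hoy]
        simp only [Set.mem_setOf_eq, Set.mem_union, Set.mem_inter_iff, Finset.mem_coe, openConn]
    _ ≤ (prodBernoulli w).real
          {ω : BondConfig (Fin n) | ∃ u ∈ (↑({o, y} : Finset (Fin n)) : Set (Fin n)), (openGraph ω).Reachable u b} := key
    _ ≤ (prodBernoulli w).real {ω : BondConfig (Fin n) | ω ∪ {s(o, y)} ∈ openConn o b} := by
        refine measureReal_mono ?_ (measure_ne_top _ _)
        rintro ω ⟨u, hu, hub⟩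
        rw [Set.mem_setOf_eq, starGlueRelay_union_pair_mem_openConn_iff hoy]
        exact Or.inr ⟨⟨o, hoB, SimpleGraph.Reachable.refl o⟩, ⟨u, Finset.mem_coe.1 hu, hub⟩⟩

end

end Summit.CriticalPhenomena.PercolationContinuityZ3.Theorems
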